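import Literature.Geometry.Lorentzian.KerrDeSitterPartialModeStability
import HarnessLib

/-!
# The master (Klein–Gordon-parameter `μ`) form of the separated equations on Kerr–de Sitter
# (Casals–Teixeira da Costa 2022, §3.2, (3.6) and (3.8))

Definitions only (no named facts). The separated radial and angular equations of
`KerrDeSitterTeukolskyRadial.lean` are the Teukolsky (massless spin-`s`) system in the convention of
Suzuki–Takasugi–Umetsu / Hatsuda; at `s = 0` that system is the CONFORMALLY coupled scalar
(`(□_g − R/6)ψ = 0`, `R = 4Λ`; Hatsuda 2020 §3.1, Novaes et al. 2019 §3.1). Casals–Teixeira da Costa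
print the same system with an extra Klein–Gordon parameter `μ`, arXiv v3 (2023) of
[CasalsTeixeiradacosta2022], §3.2: the Teukolsky equation (3.4) with right-hand side `(2μ/L²)α`,
"The parameter `μ` must be taken to be 1 if `s ≠ 0` … In the scalar case `s = 0`, `μ` represents a
dimensionless Klein–Gordon mass, interpolating be[twe]en the massless wave equation, corresponding
to `μ = 0`, and the conformal Klein–Gordon equation, corresponding to `μ = 1`"; separated angular
equation (3.6) (parameter `ν ∈ ℂ` in place of `aω`, separation constant `λ̄`):
`(1/sin θ) d/dθ(Δ_θ sin θ dS/dθ) − 2(Ξ−1)cos²θ[(μ+2s²) + (Ξ²/Δ_θ) mν]S + λ̄S`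
`− [(Ξm + s cos θ(Ξ − 2(Ξ−1)sin²θ))²/(sin²θ Δ_θ) − Ξ²ν² Ξcos²θ/Δ_θ + 2νs cos θ Ξ²/Δ_θ]S = 0`,
`Δ_θ = sin²θ + Ξ cos²θ`; and separated radial equation (3.8):
`Δ^{-s} d/dr(Δ^{1+s} dα/dr) + (1/Δ)[Ξ²(ω(r²+a²)−am)² − isΞ(ω(r²+a²)−am) dΔ/dr]α`
`+ [4isωΞr − (2/L²)(μ+3s+2s²)r² + s(1−a²/L²) − λ̄ + 2Ξ²amω − a²Ξ²ω²]α = 0`, `r ∈ (r₁, r₂)`,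
`L² = 3/Λ`, `Ξ = 1 + a²/L²`. This is the "master form with the scalar-coupling switch `μ`" the venture
`Summits/Ventures/KdS` uses for its `s = 0`, `μ ∈ {0, 1}` boxes; the boundary conditions at the
horizons and the regularity condition at the poles do not involve `μ` (the `μ`-terms are regular
there), so `IsIngoingAtEventHorizon`, `IsOutgoingAtCosmoHorizon`, `IsRegularAtPoles` are reused.

Contents: `masterRadialPotential`, `IsMasterRadialSolution`, `masterAngularPotential` (the printed
(3.6) rewritten in `x = cos θ`: `(1/sin θ)d/dθ(Δ_θ sin θ d/dθ) = d/dx((1+αx²)(1−x²)d/dx)`,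
`Δ_θ = 1 + αx²`, `Ξ − 1 = α`), `IsMasterAngularSolution`, `IsMasterAngularEigenvalue`,
`IsMasterModeSolution`, `HasMasterMode`, `NoMasterModeIn`, `MasterModeStable`; and the PROVED
identifications at `μ = 1`, `ν = aω`, `λ̄ = lambdaBar λ` with the Teukolsky-form objects:
`masterRadialPotential_one`, `masterAngularPotential_one` (the two printed coefficient lists agree —
`field_simp; ring`), `isMasterRadialSolution_one_iff`, `isMasterAngularSolution_one_iff`,
`hasMasterMode_one_iff` (for `Λ ≥ 0`, where `1 + αx² ≠ 0` on `(−1, 1)`).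

PROVED (last section): `masterAngularEigenvalue_sign` — Casals–Teixeira da Costa's Lemma 3.1,
display (3.7), in the printed generality of the master angular equation (any `μ ≥ 0`, `ν ∈ ℂ` with
`Im ν > 0`, `Λ ≥ 0`): every angular eigenvalue satisfies `Im(ν̄ λ̄) < 0`; by the printed energy
argument in boundary-flux form (`im_conj_mul_neg_of_angularODE` of the partial-mode-stability file,
with the pointwise integrand read off (3.6), `masterAngularPotential_sub`); and
`angularSign_of_master`, the `μ = 1`, `ν = aω` Teukolsky-form consequence (consistency with
`CasalsTeixeiraDaCosta2022_angularSign_holds`).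
-/

noncomputable section

open Complex Set

namespace Literature.Geometry.Lorentzian.KerrDeSitter

/-! ### Radial master equation (CTdC (3.8)) -/

/-- The zeroth-order coefficient of Casals–Teixeira da Costa's radial equation (3.8) with
Klein–Gordon parameter `μ` and their separation constant `λ̄`:
`(1/Δ)[Ξ²K² − isΞKΔ'] + 4isωΞr − (2/L²)(μ+3s+2s²)r² + s(1−a²/L²) − λ̄ + 2Ξ²amω − a²Ξ²ω²`
(`1/L² = Λ/3`, `K = ω(r²+a²) − am`). [cite: CasalsTeixeiradacosta2022, (3.8)] -/
def masterRadialPotential (M a Λ s μ : ℝ) (ω : ℂ) (m : ℝ) (lamBar : ℂ) (r : ℝ) : ℂ :=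
  ((xi a Λ : ℂ) ^ 2 * radialK a ω m r ^ 2 -
        I * (s : ℂ) * (xi a Λ : ℂ) * radialK a ω m r * (deltaDeriv M a Λ r : ℂ)) /
      (delta M a Λ r : ℂ) +
    4 * I * (s : ℂ) * ω * (xi a Λ : ℂ) * (r : ℂ) -
    ((2 * (Λ / 3) * (μ + 3 * s + 2 * s ^ 2) * r ^ 2 : ℝ) : ℂ) +
    ((s * (1 - a ^ 2 * (Λ / 3)) : ℝ) : ℂ) - lamBar +
    2 * (xi a Λ : ℂ) ^ 2 * (a : ℂ) * (m : ℂ) * ω - (a : ℂ) ^ 2 * (xi a Λ : ℂ) ^ 2 * ω ^ 2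

/-- **Classical solutions of the radial master equation** (CTdC (3.8)) on `(r₊, r_c) = (r₁, r₂)`:
`Δ α'' + (s+1)Δ' α' + masterRadialPotential · α = 0` pointwise with `HasDerivAt` witnesses
(`Δ^{-s}(Δ^{1+s}α')' = Δα'' + (s+1)Δ'α'`). [cite: CasalsTeixeiradacosta2022, (3.8)] -/
def IsMasterRadialSolution (M a Λ s μ : ℝ) (ω : ℂ) (m : ℝ) (lamBar : ℂ) (R : ℝ → ℂ) : Prop :=
  ∃ R' R'' : ℝ → ℂ, ∀ r ∈ Ioo (rPlus M a Λ) (rCosmo M a Λ),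
    HasDerivAt R (R' r) r ∧ HasDerivAt R' (R'' r) r ∧
      (delta M a Λ r : ℂ) * R'' r + ((s + 1 : ℝ) : ℂ) * (deltaDeriv M a Λ r : ℂ) * R' r +
          masterRadialPotential M a Λ s μ ω m lamBar r * R r = 0

/-- At `μ = 1` the master radial coefficient is the one of `KerrDeSitterPartialModeStability.lean`
(`(μ+3s+2s²) = (1+s)(1+2s)`). [cite: CasalsTeixeiradacosta2022, (3.8)] -/
theorem masterRadialPotential_one (M a Λ s : ℝ) (ω : ℂ) (m : ℝ) (lamBar : ℂ) (r : ℝ) :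
    masterRadialPotential M a Λ s 1 ω m lamBar r = radialPotentialCTdC M a Λ s ω m lamBar r := by
  simp only [masterRadialPotential, radialPotentialCTdC]

/-- At `μ = 1` and `λ̄ = lambdaBar λ` the master radial coefficient is the Teukolsky-form coefficient
`radialPotential` of STU (3.7) = Hatsuda (2.13). [cite: CasalsTeixeiradacosta2022, (3.8)] -/
theorem masterRadialPotential_one_lambdaBar (M a Λ s : ℝ) (ω : ℂ) (m : ℝ) (lam : ℂ) (r : ℝ) :
    masterRadialPotential M a Λ s 1 ω m (lambdaBar a Λ s ω m lam) r =
      radialPotential M a Λ s ω m lam r := by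
  rw [masterRadialPotential_one, radialPotential_eq_ctdc]

/-- At `μ = 1`, `λ̄ = lambdaBar λ`, master radial solutions are exactly the radial Teukolsky solutions.
[cite: CasalsTeixeiradacosta2022, (3.8)] -/
theorem isMasterRadialSolution_one_iff (M a Λ s : ℝ) (ω : ℂ) (m : ℝ) (lam : ℂ) (R : ℝ → ℂ) :
    IsMasterRadialSolution M a Λ s 1 ω m (lambdaBar a Λ s ω m lam) R ↔
      IsRadialTeukolskySolution M a Λ s ω m lam R := by
  simp only [IsMasterRadialSolution, IsRadialTeukolskySolution, masterRadialPotential_one_lambdaBar]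

/-! ### Angular master equation (CTdC (3.6)) in `x = cos θ` -/

/-- The zeroth-order coefficient of Casals–Teixeira da Costa's angular equation (3.6) (Klein–Gordon
parameter `μ`, parameter `ν ∈ ℂ` in place of `aω`, separation constant `λ̄`), rewritten in
`x = cos θ` with `Δ_θ = 1 + αx²`, `Ξ − 1 = α`:
`λ̄ − 2αx²[(μ+2s²) + Ξ²mν/(1+αx²)] − (Ξm + sx(Ξ − 2α(1−x²)))²/((1−x²)(1+αx²))`
`+ Ξ³ν²x²/(1+αx²) − 2νsxΞ²/(1+αx²)`. [cite: CasalsTeixeiradacosta2022, (3.6)] -/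
def masterAngularPotential (a Λ s μ : ℝ) (ν : ℂ) (m : ℝ) (lamBar : ℂ) (x : ℝ) : ℂ :=
  lamBar - ((2 * alpha a Λ * x ^ 2 * (μ + 2 * s ^ 2) : ℝ) : ℂ) -
    ((2 * alpha a Λ * x ^ 2 * xi a Λ ^ 2 * m / (1 + alpha a Λ * x ^ 2) : ℝ) : ℂ) * ν -
    (((xi a Λ * m + s * x * (xi a Λ - 2 * alpha a Λ * (1 - x ^ 2))) ^ 2 /
        ((1 - x ^ 2) * (1 + alpha a Λ * x ^ 2)) : ℝ) : ℂ) +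
    ((xi a Λ ^ 3 * x ^ 2 / (1 + alpha a Λ * x ^ 2) : ℝ) : ℂ) * ν ^ 2 -
    ((2 * s * x * xi a Λ ^ 2 / (1 + alpha a Λ * x ^ 2) : ℝ) : ℂ) * ν

/-- **Classical solutions of the angular master equation** (CTdC (3.6)) on `x = cos θ ∈ (−1, 1)`:
`(1+αx²)(1−x²)S'' + (2(α−1)x − 4αx³)S' + masterAngularPotential · S = 0`
(`(1/sin θ) d/dθ(Δ_θ sin θ dS/dθ) = d/dx((1+αx²)(1−x²) dS/dx)`).
[cite: CasalsTeixeiradacosta2022, (3.6)] -/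
def IsMasterAngularSolution (a Λ s μ : ℝ) (ν : ℂ) (m : ℝ) (lamBar : ℂ) (S : ℝ → ℂ) : Prop :=
  ∃ S' S'' : ℝ → ℂ, ∀ x ∈ Ioo (-1 : ℝ) 1,
    HasDerivAt S (S' x) x ∧ HasDerivAt S' (S'' x) x ∧
      (((1 + alpha a Λ * x ^ 2) * (1 - x ^ 2) : ℝ) : ℂ) * S'' x +
            ((2 * (alpha a Λ - 1) * x - 4 * alpha a Λ * x ^ 3 : ℝ) : ℂ) * S' x +
          masterAngularPotential a Λ s μ ν m lamBar x * S x = 0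

/-- At `μ = 1`, `ν = aω`, `λ̄ = lambdaBar λ` the master angular coefficient (CTdC (3.6)) IS the
Teukolsky-form coefficient `angularPotential` (Hatsuda (2.5)): the two printed rational functions of
`x` agree wherever `1 − x² ≠ 0`, `1 + αx² ≠ 0`, `1 + α ≠ 0` — the same `λ̄ ↔ λ` map as for the radial pair.
[cite: CasalsTeixeiradacosta2022, (3.6)] -/
theorem masterAngularPotential_one (a Λ s : ℝ) (ω : ℂ) (m : ℝ) (lam : ℂ) {x : ℝ}
    (hx : 1 - x ^ 2 ≠ 0) (hα : 1 + alpha a Λ * x ^ 2 ≠ 0) (hΞ : 1 + alpha a Λ ≠ 0) :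
    masterAngularPotential a Λ s 1 ((a : ℂ) * ω) m (lambdaBar a Λ s ω m lam) x =
      angularPotential a Λ s ω m lam x := by
  have hx' : (1 : ℂ) - (x : ℂ) ^ 2 ≠ 0 := by exact_mod_cast hx
  have hα' : (1 : ℂ) + (alpha a Λ : ℂ) * (x : ℂ) ^ 2 ≠ 0 := by exact_mod_cast hα
  have hΞ' : (1 : ℂ) + (alpha a Λ : ℂ) ≠ 0 := by exact_mod_cast hΞ
  simp only [masterAngularPotential, angularPotential, lambdaBar, xi_eq_one_add_alpha]
  push_cast
  field_simp
  ring

/-- At `μ = 1`, `ν = aω`, `λ̄ = lambdaBar λ` and `Λ ≥ 0` (so that `1 + αx² > 0` on `(−1, 1)`),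
master angular solutions are exactly the angular Teukolsky solutions.
[cite: CasalsTeixeiradacosta2022, (3.6)] -/
theorem isMasterAngularSolution_one_iff (a Λ s : ℝ) (hΛ : 0 ≤ Λ) (ω : ℂ) (m : ℝ) (lam : ℂ)
    (S : ℝ → ℂ) :
    IsMasterAngularSolution a Λ s 1 ((a : ℂ) * ω) m (lambdaBar a Λ s ω m lam) S ↔
      IsAngularTeukolskySolution a Λ s ω m lam S := by
  have key : ∀ x ∈ Ioo (-1 : ℝ) 1,
      masterAngularPotential a Λ s 1 ((a : ℂ) * ω) m (lambdaBar a Λ s ω m lam) x =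
        angularPotential a Λ s ω m lam x := by
    intro x hx
    have h1 : 1 - x ^ 2 ≠ 0 := by
      have : x ^ 2 < 1 := by nlinarith [hx.1, hx.2]
      linarith
    have h2 : 1 + alpha a Λ * x ^ 2 ≠ 0 := by
      have : 0 ≤ alpha a Λ * x ^ 2 := by unfold alpha; positivity
      linarith
    have h3 : 1 + alpha a Λ ≠ 0 := by
      have : 0 ≤ alpha a Λ := by unfold alpha; positivity
      linarith
    exact masterAngularPotential_one a Λ s ω m lam h1 h2 h3
  constructor
  · rintro ⟨S', S'', h⟩
    refine ⟨S', S'', fun x hx => ?_⟩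
    obtain ⟨hd1, hd2, heq⟩ := h x hx
    exact ⟨hd1, hd2, by rw [← key x hx]; exact heq⟩
  · rintro ⟨S', S'', h⟩
    refine ⟨S', S'', fun x hx => ?_⟩
    obtain ⟨hd1, hd2, heq⟩ := h x hx
    exact ⟨hd1, hd2, by rw [key x hx]; exact heq⟩

/-! ### Mode solutions of the master system -/

/-- `λ̄` is an **angular eigenvalue of the master angular equation** for `(s, μ, m, ν)`: a non-trivial
solution regular at both poles exists (CTdC Lemma 3.1's boundary condition; same pole exponents
`|m∓s|/2` as in the Teukolsky form, the `μ`-term being regular at `x = ±1`).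
[cite: CasalsTeixeiradacosta2022, Lemma 3.1] -/
def IsMasterAngularEigenvalue (a Λ s μ : ℝ) (ν : ℂ) (m : ℝ) (lamBar : ℂ) : Prop :=
  ∃ S : ℝ → ℂ, IsMasterAngularSolution a Λ s μ ν m lamBar S ∧ IsRegularAtPoles s m S ∧
    ∃ x ∈ Ioo (-1 : ℝ) 1, S x ≠ 0

/-- **Mode solution of the master system** (CTdC Def. 3.4 read with the Klein–Gordon parameter `μ`
of (3.4)–(3.8), generic boundary bullets): `λ̄` an angular eigenvalue at `ν = aω`, the radial function
a non-trivial classical solution on `(r₊, r_c)`, ingoing at `𝓗⁺` and outgoing at `𝓗⁺_c` (horizon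
exponents do not involve `μ`). For `μ = 1` these are the Teukolsky modes (`hasMasterMode_one_iff`);
for `s = 0`, `μ = 0` the modes of the massless wave equation `□_g ψ = 0`.
[cite: CasalsTeixeiradacosta2022, Definition 3.4] -/
def IsMasterModeSolution (M a Λ s μ : ℝ) (ω : ℂ) (m : ℝ) (lamBar : ℂ) (R : ℝ → ℂ) : Prop :=
  IsMasterAngularEigenvalue a Λ s μ ((a : ℂ) * ω) m lamBar ∧
    IsMasterRadialSolution M a Λ s μ ω m lamBar R ∧
      IsIngoingAtEventHorizon M a Λ s ω m R ∧ IsOutgoingAtCosmoHorizon M a Λ ω m R ∧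
        ∃ r ∈ Ioo (rPlus M a Λ) (rCosmo M a Λ), R r ≠ 0

/-- `(ω, m)` carries a mode of the master system with parameters `(s, μ)`.
[cite: CasalsTeixeiradacosta2022, Definition 3.4] -/
def HasMasterMode (M a Λ s μ : ℝ) (ω : ℂ) (m : ℝ) : Prop :=
  ∃ (lamBar : ℂ) (R : ℝ → ℂ), IsMasterModeSolution M a Λ s μ ω m lamBar R

/-- No master-system mode with `(ω, m)` in the window `W` (admissible `m`: `m − s ∈ ℤ`).
[cite: CasalsTeixeiradacosta2022, Definition 3.4] -/
def NoMasterModeIn (M a Λ s μ : ℝ) (W : Set (ℂ × ℝ)) : Prop :=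
  ∀ ω : ℂ, ∀ m : ℝ, (ω, m) ∈ W → (∃ k : ℤ, m - s = k) → ¬HasMasterMode M a Λ s μ ω m

/-- Mode stability of the master system with parameters `(s, μ)` at `(M, a, Λ)`: no mode with
`Im ω ≥ 0`, `ω ≠ 0`. [cite: CasalsTeixeiradacosta2022, Definition 3.4] -/
def MasterModeStable (M a Λ s μ : ℝ) : Prop := NoMasterModeIn M a Λ s μ unstableWindow

/-- Shrinking the window preserves "no master mode" (immediate from the definition).
[cite: CasalsTeixeiradacosta2022, Definition 3.4] -/
theorem NoMasterModeIn.mono {M a Λ s μ : ℝ} {W W' : Set (ℂ × ℝ)} (h : NoMasterModeIn M a Λ s μ W)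
    (hW : W' ⊆ W) : NoMasterModeIn M a Λ s μ W' :=
  fun ω m hm hadm => h ω m (hW hm) hadm

/-- At `μ = 1` (and `Λ ≥ 0`) the master-system modes are exactly the Teukolsky modes of
`KerrDeSitterTeukolskyRadial.lean` (`λ̄ = lambdaBar λ` is a bijection `λ ↦ λ̄`).
[cite: CasalsTeixeiradacosta2022, Definition 3.4] -/
theorem hasMasterMode_one_iff (M a Λ s : ℝ) (hΛ : 0 ≤ Λ) (ω : ℂ) (m : ℝ) :
    HasMasterMode M a Λ s 1 ω m ↔ HasMode M a Λ s ω m := by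
  -- the affine change of separation constant and its inverse
  let toBar : ℂ → ℂ := fun lam => lambdaBar a Λ s ω m lam
  let ofBar : ℂ → ℂ := fun lamBar =>
    lamBar + ((s * (1 - alpha a Λ) : ℝ) : ℂ) -
      (xi a Λ : ℂ) ^ 2 * (2 * (a : ℂ) * (m : ℂ) * ω - (a : ℂ) ^ 2 * ω ^ 2)
  have h_of : ∀ lamBar, toBar (ofBar lamBar) = lamBar := by
    intro lamBar; simp only [toBar, ofBar, lambdaBar]; ring
  constructor
  · rintro ⟨lamBar, R, ⟨S, hS, hreg, hSne⟩, hR, hin, hout, hne⟩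
    refine ⟨ofBar lamBar, R, ⟨S, ?_, hreg, hSne⟩, ?_, hin, hout, hne⟩
    · rw [← isMasterAngularSolution_one_iff a Λ s hΛ ω m (ofBar lamBar) S]
      simpa only [toBar, h_of lamBar] using hS
    · rw [← isMasterRadialSolution_one_iff M a Λ s ω m (ofBar lamBar) R]
      simpa only [toBar, h_of lamBar] using hR
  · rintro ⟨lam, R, ⟨S, hS, hreg, hSne⟩, hR, hin, hout, hne⟩
    refine ⟨toBar lam, R, ⟨S, ?_, hreg, hSne⟩, ?_, hin, hout, hne⟩
    · exact (isMasterAngularSolution_one_iff a Λ s hΛ ω m lam S).2 hS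
    · exact (isMasterRadialSolution_one_iff M a Λ s ω m lam R).2 hR

/-- Consequently, at `μ = 1` (and `Λ ≥ 0`) "no master mode in `W`" is "no Teukolsky mode in `W`".
[cite: CasalsTeixeiradacosta2022, Definition 3.4] -/
theorem noMasterModeIn_one_iff (M a Λ s : ℝ) (hΛ : 0 ≤ Λ) (W : Set (ℂ × ℝ)) :
    NoMasterModeIn M a Λ s 1 W ↔ NoModeIn M a Λ s W := by
  simp only [NoMasterModeIn, NoModeIn, hasMasterMode_one_iff M a Λ s hΛ]

section MasterAngularSign

open scoped ComplexConjugate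

/-! ### Lemma 3.1 (3.7) for the master angular equation (Klein–Gordon parameter `μ`) -/

/-- The printed grouping for the master angular coefficient (CTdC (3.6), any `μ`):
`V_μ(x) − λ̄ = A(x)ν² + B(x)ν − N_μ(x)` with `A = Ξ³x²/Δ_θ`, `B = −2Ξ²x(αmx + s)/Δ_θ` and
`N_μ = 2(Ξ−1)x²(μ+2s²) + (Ξm + sx(Ξ − 2(Ξ−1)(1−x²)))²/((1−x²)Δ_θ)` — read off from (3.6).
[cite: CasalsTeixeiradacosta2022, Lemma 3.1 (proof)] -/
theorem masterAngularPotential_sub (a Λ s μ : ℝ) (ν : ℂ) (m : ℝ) (lamBar : ℂ) (x : ℝ) :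
    masterAngularPotential a Λ s μ ν m lamBar x - lamBar =
      ((xi a Λ ^ 3 * x ^ 2 / (1 + alpha a Λ * x ^ 2) : ℝ) : ℂ) * ν ^ 2 +
        ((-(2 * xi a Λ ^ 2 * x * (alpha a Λ * m * x + s)) / (1 + alpha a Λ * x ^ 2) : ℝ) : ℂ) * ν -
        ((2 * alpha a Λ * x ^ 2 * (μ + 2 * s ^ 2) +
            (xi a Λ * m + s * x * (xi a Λ - 2 * alpha a Λ * (1 - x ^ 2))) ^ 2 /
              ((1 - x ^ 2) * (1 + alpha a Λ * x ^ 2)) : ℝ) : ℂ) := by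
  simp only [masterAngularPotential]
  push_cast
  ring

/-- **Casals–Teixeira da Costa 2022, Lemma 3.1, display (3.7), in the printed generality — proved**:
for the master angular equation (3.6) with Klein–Gordon parameter `μ ≥ 0` (the paper's
`μ ∈ {0, 1}`), parameter `ν ∈ ℂ` with `Im ν > 0`, `Λ ≥ 0`, every angular eigenvalue `λ̄` (non-trivial
solution regular at both poles) satisfies `Im(ν̄ λ̄) < 0` ("The eigenvalues … satisfy
`Im ν > 0 ⟹ Im(ν̄ λ̄) < 0`"). Same printed proof as `CasalsTeixeiraDaCosta2022_angularSign_holds`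
(boundary-flux form of the `sin θ · conj(νS)`-weighted energy identity; the `μ`-term contributes the
printed non-negative summand `2(Ξ−1)cos²θ(μ+2s²)|S|²`). At `μ = 0`, `s = 0` this is the angular input
of the massless-scalar (`□_g`) boxes of venture `Summits/Ventures/KdS`.
[cite: CasalsTeixeiradacosta2022, Lemma 3.1] -/
theorem masterAngularEigenvalue_sign {a Λ s μ : ℝ} {ν : ℂ} {m : ℝ} {lamBar : ℂ} (hΛ : 0 ≤ Λ)
    (hμ : 0 ≤ μ) (hν : 0 < ν.im) (h : IsMasterAngularEigenvalue a Λ s μ ν m lamBar) :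
    (conj ν * lamBar).im < 0 := by
  obtain ⟨S, ⟨S', S'', hS⟩, hreg, hnt⟩ := h
  have hα : 0 ≤ alpha a Λ := by unfold alpha; positivity
  have hξ : 0 < xi a Λ := xi_pos hΛ a
  have hnc : 0 < normSq ν := by
    refine Complex.normSq_pos.mpr fun h => ?_
    rw [h] at hν
    simp at hν
  have hN : ∀ x ∈ Ioo (-1 : ℝ) 1, 0 ≤ 2 * alpha a Λ * x ^ 2 * (μ + 2 * s ^ 2) +
      (xi a Λ * m + s * x * (xi a Λ - 2 * alpha a Λ * (1 - x ^ 2))) ^ 2 /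
        ((1 - x ^ 2) * (1 + alpha a Λ * x ^ 2)) := by
    intro x hx
    have hx2 : 0 < 1 - x ^ 2 := by nlinarith [hx.1, hx.2]
    positivity
  refine im_conj_mul_neg_of_angularODE hα hν (s := s) (m := m)
    (V := fun x => masterAngularPotential a Λ s μ ν m lamBar x) (lamBar := lamBar) hS hreg hnt
    ?_ ?_
  · intro x hx
    have h := congrArg (fun z => (conj ν * z).im) (masterAngularPotential_sub a Λ s μ ν m lamBar x)
    rw [h, im_conj_mul_quadratic]
    have hA : 0 ≤ xi a Λ ^ 3 * x ^ 2 / (1 + alpha a Λ * x ^ 2) * normSq ν := by positivity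
    exact mul_nonneg hν.le (add_nonneg hA (hN x hx))
  · intro x hx hx0
    have h := congrArg (fun z => (conj ν * z).im) (masterAngularPotential_sub a Λ s μ ν m lamBar x)
    rw [h, im_conj_mul_quadratic]
    have hxsq : 0 < x ^ 2 := sq_pos_of_ne_zero hx0
    have hA : 0 < xi a Λ ^ 3 * x ^ 2 / (1 + alpha a Λ * x ^ 2) * normSq ν := by positivity
    exact mul_pos hν (add_pos_of_pos_of_nonneg hA (hN x hx))

/-- The Teukolsky-form statement recovered from the master form at `μ = 1`, `ν = aω`, `a > 0`
(consistency check of the two renderings; `Im(ν̄ λ̄) = a · Im(λ̄ ω̄)`).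
[cite: CasalsTeixeiradacosta2022, Lemma 3.1] -/
theorem angularSign_of_master {a Λ s : ℝ} {ω : ℂ} {m : ℝ} {lam : ℂ} (hΛ : 0 ≤ Λ) (ha : 0 < a)
    (hω : 0 < ω.im) (h : IsAngularEigenvalue a Λ s ω m lam) :
    (lambdaBar a Λ s ω m lam * conj ω).im < 0 := by
  obtain ⟨S, hS, hreg, hnt⟩ := h
  have hm : IsMasterAngularEigenvalue a Λ s 1 ((a : ℂ) * ω) m (lambdaBar a Λ s ω m lam) :=
    ⟨S, (isMasterAngularSolution_one_iff a Λ s hΛ ω m lam S).2 hS, hreg, hnt⟩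
  have hν : 0 < ((a : ℂ) * ω).im := by simpa [mul_im] using mul_pos ha hω
  have key := masterAngularEigenvalue_sign hΛ zero_le_one hν hm
  have hid : (conj ((a : ℂ) * ω) * lambdaBar a Λ s ω m lam).im =
      a * (lambdaBar a Λ s ω m lam * conj ω).im := by
    simp only [map_mul, Complex.conj_ofReal, mul_im, mul_re, ofReal_re, ofReal_im, conj_re,
      conj_im]
    ring
  rw [hid] at key
  exact neg_of_mul_neg_right key ha.le

end MasterAngularSign

end Literature.Geometry.Lorentzian.KerrDeSitter

end
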